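import Literature.MathematicalPhysics.QuantumFieldTheory.Balaban1983to89.B9Thm312WholeFromThm310L2
import Literature.MathematicalPhysics.QuantumFieldTheory.Balaban1983to89.B9RWSumsDefinitePinsPairM
import Literature.MathematicalPhysics.QuantumFieldTheory.Balaban1983to89.B9Thm312WholeStepFrom3131

/-!
# BalabanUVNodes ∕ N06 ([B9], `Dag.B9_main`) — THE «THEOREM 3.3 FOR G₀» LAYER OF ROWS 20–21 DERIVED FROM ROWS 18–19's
# THEOREM-3.10 SCHEMAS AT def-Y's MEMBERS (G₀ := G(U), p. 421), WITH EVERY THRESHOLD AND CONSTANT CHOSEN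

Track A of `YM-PLAN.md` (cell `pub-ymgap`, HUMAN RULING D-0062), node **N06** = [Balaban1985BackgroundPropagators] Thms 3.1–3.15;
seat `pub-ymgap-dag-n06-d` (s2, «knit N06 at the ₁₁ record»).  A HELPER for the stage-11 certificate editions ≥ 13.

WHAT.  In the certificate of record (`…N06AtOpsYNuOfRecordV6EPairMR`, edition 12) rows 20–21 (Theorems 3.12–3.13) display, among
their hypotheses, the «Theorem 3.3 for G₀» layer about Sect. D's unperturbed propagator G₀ — `Thm33G0` (the first conjunct of
`hmodel12`), the `e1` member of `LeftStep` (`hleft12`), and the direction-indexed ∕ Hölder ∕ input ∕ L² members `Thm33G0Dir ∧ Thm33G0DirR ∧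
Thm33G0L2M` (`hG0C`) — while rows 18–19 display Theorem 3.10's walk-expansion schemas about the Sect. A–C propagator G(U)
(`h36A h36HA`: Cor. 3.6's blocks `Local342G`, the (3.89) factors, the structure (3.105), the Hölder ∕ input ∕ second-order ∕ mixed legs and
their factor bounds).  Print (p. 421): G₀ *"is the operator we have investigated in previous sections"*, i.e. G₀ = G(U); at def-Y's pins
both letter records read the SAME coordinate model (`hG0co12` = `hGcoA`, `hblk12` = `hblkA`, …).  n06-l g10's
`B9Thm312WholeFromThm310(L2)` turned that identification into theorems at one member and one U (`thm33G0_of_conv3107`,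
`leftStep_of_conv3107`, `thm33G0DirR_of_conv3107`, `thm33G0Dir_of_conv3107`, `thm33G0L2M_of_conv3107`, on n06-k's operator-level
`conv3107_of_local3107`, `holder343_of_local310`, `inputPair3445_of_local310`, `l2line3∕4∕5_of_local310`, `l2mixed_of_local310`), and
n06-l g11's `B9Thm312WholeStepFrom3131.step_of_letters3131` turned Theorem 3.3 for G₀ + the (3.131)∕(3.137) letters into the two sup-class
perturbation STEPS of rows 20–21 (`hmodel12`'s conjuncts 2–3).

THIS FILE knits them AT def-Y's MEMBERS `x : MemberY …` over the geometry of record `geo9Y`, choosing every threshold and constant: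
★★ `g0_layer_of_thm310_schemas` — from one side's primitive constants `q : PinPrims` (+ `q3 : PairPrims`, `qM : MixedPrims`), the
Theorem-3.10 schemas of rows 18–19 in THEIR regime (M ≧ q.M₁, 0 < α₀, c₃₅Mα₀ ≦ q.a₁, (3.35)) — `h36A`, `h36HA` VERBATIM as the certificate
displays them, plus the two-sided L² leg schema `h36A2` (`L2TwoLegs310 ∧ FactorsL2_310`, the species the PairM face had dropped) — the
symmetry ∕ transposition facts of G(U) (`hsymA htrA`, theorems at the pins in the certificate), the five letter identifications
(`hblk hblkY hG0 hD hDs`), and rows 20–21's GENUINE Sect.-D content in THEIR regime (M ≧ M₁₂, 0 < α₀, Mα₀ ≦ a₁₂, (3.35), (3.36)):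
the form smallness `FormSmall` and the identities `Identities` (`hrest12`), the two left steps ∇_UG₀Δ′_π, ∇_UG₀(Δ′_π + Δ⁽²⁾_π) :
𝔠⁽²⁾ → 𝔠⁽¹⁾ (`hstepD12`), the G₀D entry of Theorem 3.3's type (`hgD12`, row 21's `Letters313.gD2`) and print's (3.131) ∕ (3.137)
letters Δ′_π = T_a + D·T_b, Δ⁽²⁾_π = T_a₂ + D·T_b₂ with small local majorants (`hL3131`, n06-l g11's `Letters3131` over FREE letters
`Ta Ta₂ Tb Tb₂`) — we get thresholds (M₀, a₀) with M₁₂ ≦ M₀, a₀ ≦ a₁₂, constants B₀ ≧ 0 (= `const37` at the definite (2.61) exponent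
`exp261 geo9Y q.δ₀ q.α`), B_h, B_i, B_i2 ≧ 0 (n06-k's `holderConst ∕ inputConst44 ∕ inputConst45`), B₂ ≧ 0 (the maximum of the four L²
lower bounds) and the step constant θ₁₂ ≧ 0 (= 2(B₀ + B₃)·t·c·L₀, n06-l g11's `step_of_letters3131`: p. 422 *"This inequality and
Theorem 3.3 for G₀ imply a convergence of the series (3.130)"*), such that in the regime (M₀, a₀) the THREE displayed binder families
of the certificate hold: `Thm33G0 ∧ Step ∧ Step ∧ FormSmall ∧ Identities` (= `hmodel12`, the two sup-class STEPS now DERIVED),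
`LeftStep` (= `hleft12`), `Thm33G0Dir ∧ Thm33G0DirR ∧ Thm33G0L2M` (= `hG0C`), at any rate δ₁₂₀ ≦ (1 − 3α_F)(1 − 2α)δ₀ and any step
rate δ_K with δ_K + α_F(1 − 2α)δ₀ ≦ ρ_S ≦ δ_T, ρ_S + σ_S ≦ min(δ₁₂₀, δ₁₂₃).  «M sufficiently large» is M₀ := max(M₁₂, q.M₁, M_L, 1,
2N_Fθ₀c₁, M_σ) with M_L the (2.59) threshold of n06-i's `lemma21Pack_geo9Y` and M_σ that of `rowSum261_geo9Y` at rate σ_S ([4] Lemma 2.1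
and p. 398's member facts at the record, ZERO hypotheses about the geometry); «α₀ sufficiently small» is a₀ := min(a₁₂, q.a₁∕c₃₅).

HONEST FRAMING.  Kernel bookkeeping (thresholds, constants, six applications of n06-l's theorems per member); COUNT-NEUTRAL; nothing of
[B9] asserted — Theorem 3.10's estimates for Bałaban's G(U) at U ≠ 1 remain the displayed schemas `h36A h36HA h36A2`; N06 NOT discharged.
One finite 𝕋⁴ programme at fixed `ε` — NOT continuum, NOT OS, NOT the mass gap ∕ Clay.  0 `def`, 0 `sorry`.
-/

noncomputable section

namespace Summit.QuantumFields.YangMills.BalabanUVNodes.N06G0LayerFromThm310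

open Literature.MathematicalPhysics.QuantumFieldTheory.Balaban1983to89
open Literature.MathematicalPhysics.QuantumFieldTheory.Balaban1983to89.B9Thm34Ext (toB6)
open Literature.MathematicalPhysics.QuantumFieldTheory.Balaban1983to89.B11SectG (BlockNorm HasMaj)
open Literature.MathematicalPhysics.QuantumFieldTheory.Balaban1983to89.B9Thm37Glue (IsTransposePair)
open Literature.MathematicalPhysics.QuantumFieldTheory.Balaban1983to89.B9Thm37Whole (const37)
open Literature.MathematicalPhysics.QuantumFieldTheory.Balaban1983to89.B9Thm312Whole (Thm33G0 FormSmall cNorm)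
open Literature.MathematicalPhysics.QuantumFieldTheory.Balaban1983to89.B9Thm312WholeLeft (LeftStep)
open Literature.MathematicalPhysics.QuantumFieldTheory.Balaban1983to89.B9Thm312WholeDir (Thm33G0Dir Thm33G0L2M)
open Literature.MathematicalPhysics.QuantumFieldTheory.Balaban1983to89.B9Thm313WholeDir (Thm33G0DirR)
open Literature.MathematicalPhysics.QuantumFieldTheory.Balaban1983to89.B9Thm310Whole
  (Ops310 StaticOK310 Sizes310 Local342G Identities310 Conv3107 conv3107_of_local3107)
open Literature.MathematicalPhysics.QuantumFieldTheory.Balaban1983to89.B9RWSums343Holder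
  (HolderProbes HolderLegs310 FactorsHolder310 holderConst)
open Literature.MathematicalPhysics.QuantumFieldTheory.Balaban1983to89.B9RWSums344Input (inputConst44 inputConst45)
open Literature.MathematicalPhysics.QuantumFieldTheory.Balaban1983to89.B9RWSums344InputPair
  (InputLegsPair310 FactorsInputPair310 DirSupHolder310)
open Literature.MathematicalPhysics.QuantumFieldTheory.Balaban1983to89.B9RWSums346SecondDiff
  (DirOps310 DirTranspose310 L2SecondLegs310 FactorsL2Second310 secondConst secondConst_nonneg)
open Literature.MathematicalPhysics.QuantumFieldTheory.Balaban1983to89.B9RWSums346MixedPair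
  (L2MixedLegs310 FactorsL2Mixed310 DirSup310 mixedConst mixedConst_nonneg)
open Literature.MathematicalPhysics.QuantumFieldTheory.Balaban1983to89.B9RWSums346Two (L2TwoLegs310 FactorsL2_310 twoConst)
open Literature.MathematicalPhysics.QuantumFieldTheory.Balaban1983to89.B9RWSums343to347Whole (Facts347)
open Literature.MathematicalPhysics.QuantumFieldTheory.Balaban1983to89.B6RandomWalk (Ineq261 c1_nonneg)
open Literature.MathematicalPhysics.QuantumFieldTheory.Balaban1983to89.B9RWSumsDefinitePins (PinPrims)
open Literature.MathematicalPhysics.QuantumFieldTheory.Balaban1983to89.B9RWSumsDefinitePinsPair (PairPrims)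
open Literature.MathematicalPhysics.QuantumFieldTheory.Balaban1983to89.B9RWSumsDefinitePinsPairM (MixedPrims)
open Literature.MathematicalPhysics.QuantumFieldTheory.Balaban1983to89.B9RWSums347DefiniteFaces (exp261 lemma21Pack_geo9Y)
open Literature.MathematicalPhysics.QuantumFieldTheory.Balaban1983to89.B9PinMembersKLevelV1 (MemberY geo9Y)
open Literature.MathematicalPhysics.QuantumFieldTheory.Balaban1983to89.B9GeoLemma21KLevelV1 (geo9Y_len_pos)
open Literature.MathematicalPhysics.QuantumFieldTheory.Balaban1983to89.B9Thm312WholeFromThm310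
  (thm33G0_of_conv3107 leftStep_of_conv3107 thm33G0DirR_of_conv3107 thm33G0Dir_of_conv3107)
open Literature.MathematicalPhysics.QuantumFieldTheory.Balaban1983to89.B9Thm312WholeFromThm310L2 (thm33G0L2M_of_conv3107)
open Literature.MathematicalPhysics.QuantumFieldTheory.Balaban1983to89.B9Thm312WholeStepFrom3131 (Letters3131 step_of_letters3131)
open Literature.MathematicalPhysics.QuantumFieldTheory.Balaban1983to89.B9Thm312Whole (GeoOK)
open Literature.MathematicalPhysics.QuantumFieldTheory.Balaban1983to89.B9GeoLemma21KLevelV1 (rowSum261_geo9Y)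
open Literature.MathematicalPhysics.QuantumFieldTheory.Balaban1983to89.B11SectG (RowSum)

variable {d ℓ : ℕ} {hd : 1 ≤ d + 1} {hL : Odd (ℓ + 1) ∧ 1 < ℓ + 1} {b₀ b₁ : ℝ} {Mstar : ℕ}
variable [∀ x : MemberY d ℓ hd hL b₀ b₁ Mstar, Fintype (geo9Y x).Site]
  [∀ x : MemberY d ℓ hd hL b₀ b₁ Mstar, DecidableEq (geo9Y x).Site]
variable {c35 : ℝ} {bg : MemberY d ℓ hd hL b₀ b₁ Mstar → B9.Backgrounds}

/-- «for M sufficiently large»: M ≧ 2N_Fθ₀c₁ gives N_F·θ₀M⁻¹·c₁ ≦ ½ (the located smallness of `conv3107_of_local3107`; the lineage's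
private arithmetic, restated). [folklore] -/
private theorem small_of_threshold {NF θ₀ c M : ℝ} (hM : 0 < M) (hbig : 2 * NF * θ₀ * c ≤ M) :
    NF * (θ₀ * M⁻¹) * c ≤ 1 / 2 := by
  have h1 : NF * (θ₀ * M⁻¹) * c = (NF * θ₀ * c) / M := by
    rw [div_eq_mul_inv]
    ring
  rw [h1, div_le_iff₀ hM]
  linarith

/-- n06-k's Hölder constant `holderConst` is ≧ 0 for nonnegative letters (its own nonnegativity lemma is private). [folklore] -/
private theorem holderConst_nonneg' {dd : ℕ} {δ₀ α NH NF C b t : ℝ} (hNH : 0 ≤ NH) (hNF : 0 ≤ NF) (hC : 0 ≤ C) (hb : 0 ≤ b)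
    (ht : 0 ≤ t) : 0 ≤ holderConst dd δ₀ α NH NF C b t := by
  have hc1 : 0 ≤ B6.c1 dd δ₀ α := c1_nonneg dd δ₀ α
  unfold holderConst
  have h1 : 0 ≤ 2 * NH * b * B6.c1 dd δ₀ α := mul_nonneg (mul_nonneg (mul_nonneg (by norm_num) hNH) hb) hc1
  have h2 : 0 ≤ NH * b := mul_nonneg hNH hb
  have h3 : 0 ≤ NF * t * C * B6.c1 dd δ₀ α := mul_nonneg (mul_nonneg (mul_nonneg hNF ht) hC) hc1
  linarith

/-- n06-k's (3.44) constant `inputConst44` is ≧ 0 for nonnegative letters. [folklore] -/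
private theorem inputConst44_nonneg' {d₁ : ℕ} {δ₁ α₁ NI NF C L₀ b t : ℝ} (hNI : 0 ≤ NI) (hNF : 0 ≤ NF) (hC : 0 ≤ C)
    (hL₀ : 0 ≤ L₀) (hb : 0 ≤ b) (ht : 0 ≤ t) : 0 ≤ inputConst44 d₁ δ₁ α₁ NI NF C L₀ b t := by
  have hc1 : 0 ≤ B6.c1 d₁ δ₁ α₁ := c1_nonneg d₁ δ₁ α₁
  unfold inputConst44
  exact add_nonneg (mul_nonneg hNI hb) (mul_nonneg (mul_nonneg (mul_nonneg hC (mul_nonneg hNF ht)) hL₀) hc1)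

/-- n06-k's (3.45) constant `inputConst45` is ≧ 0 for nonnegative letters. [folklore] -/
private theorem inputConst45_nonneg' {d₁ : ℕ} {δ₁ α₁ NI NF L₀ hc b t : ℝ} (hNI : 0 ≤ NI) (hNF : 0 ≤ NF) (hL₀ : 0 ≤ L₀)
    (hhc : 0 ≤ hc) (hb : 0 ≤ b) (ht : 0 ≤ t) : 0 ≤ inputConst45 d₁ δ₁ α₁ NI NF L₀ hc b t := by
  have hc1 : 0 ≤ B6.c1 d₁ δ₁ α₁ := c1_nonneg d₁ δ₁ α₁
  unfold inputConst45
  exact add_nonneg (mul_nonneg hNI hb) (mul_nonneg (mul_nonneg (mul_nonneg hhc (mul_nonneg hNF ht)) hL₀) hc1)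

set_option maxHeartbeats 400000 in
/-- ★★ **THE «THEOREM 3.3 FOR G₀» LAYER OF ROWS 20–21 FROM ROWS 18–19's THEOREM-3.10 SCHEMAS, AT def-Y's MEMBERS, EVERY THRESHOLD
AND CONSTANT CHOSEN** (module docstring).  Inputs: one side's primitive constants `q q3 qM` with their signs; the Theorem-3.10 letters
`𝔬A` (n06-k's `Ops310`), Hölder probes `𝔭A`, direction letters `𝔡A`, input norm `bHXA`, sizes `κA`, supports `SHA S3A SIA SMA S2A`, static
data `hstA hκA` and the SCHEMAS `h36A h36HA h36A2` + counts in Theorem 3.10's regime; the symmetry ∕ transposition facts `hsymA htrA`;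
the Theorem-3.12 letters `𝔬12` (`B9Thm312Whole.Ops`, same carriers) with the five identifications G₀ := G(U) (`hblk hblkY hG0 hD hDs`);
rows 20–21's numerics `θD12 r12 δ12₀ δK12 a12 M12 B12₃ δ12₃ t12 δT12 ρS σS` with their signs and rate relations; and rows 20–21's
genuine Sect.-D schemas in Theorem 3.12's regime: `hrest12` (form smallness, identities), `hstepD12` (the two left steps), `hgD12`
(the G₀D entry) and `hL3131` (the (3.131)∕(3.137) letters).  Output: thresholds M₀ ≥ M12, a₀ ≤ a12 (both positive) and constants
B₀, B_h, B_i, B_i2, B₂, θ₁₂ (with their signs) such that the certificate's three displayed families `hmodel12` (its two sup-class steps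
DERIVED), `hleft12`, `hG0C` HOLD in the regime (M₀, a₀).  Nothing of print asserted.
[cite: Balaban1985BackgroundPropagators, Thm 3.10 (3.105)–(3.108) pp.414–416 + Thm 3.3 p.399 + p.421 (G₀) + (3.42)–(3.46) pp.397–398 + (3.130)–(3.131) pp.421–422 + (3.137)–(3.138) p.423 + Thm 3.12 p.423;
Balaban1984PropagatorsII, (2.51)–(2.55) p.232 + Lemma 2.1 (2.59)–(2.61) pp.233–234] -/
theorem g0_layer_of_thm310_schemas {X Y ι A PX PY Z W : MemberY d ℓ hd hL b₀ b₁ Mstar → Type} {P : MemberY d ℓ hd hL b₀ b₁ Mstar → Type}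
    [∀ x, Fintype (X x)] [∀ x, DecidableEq (X x)] [∀ x, Fintype (Y x)] [∀ x, DecidableEq (Y x)] [∀ x, Fintype (ι x)]
    [∀ x, Fintype (A x)] [∀ x, Fintype (PX x)] [∀ x, DecidableEq (PX x)] [∀ x, Fintype (PY x)] [∀ x, DecidableEq (PY x)]
    [∀ x, Fintype (Z x)] [∀ x, Fintype (W x)]
    (hc35 : 0 < c35) (q : PinPrims) (hq : q.OK) (q3 : PairPrims) (hq3 : q3.OK) (qM : MixedPrims) (hqM : qM.OK)
    (H : MemberY d ℓ hd hL b₀ b₁ Mstar → Prop)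
    -- the Theorem-3.10 letters of rows 18–19 (G side) and their schemas, VERBATIM as the certificate displays them
    (𝔬A : ∀ x : MemberY d ℓ hd hL b₀ b₁ Mstar, Ops310 (geo9Y x) (bg x) (X x) (Y x) (ι x) (A x))
    (𝔭A : ∀ x : MemberY d ℓ hd hL b₀ b₁ Mstar, HolderProbes (geo9Y x) (bg x) (X x) (Y x) (PX x) (PY x))
    (𝔡A : ∀ x : MemberY d ℓ hd hL b₀ b₁ Mstar, DirOps310 (𝔬A x) (P x))
    (bHXA : ∀ x : MemberY d ℓ hd hL b₀ b₁ Mstar, ℝ → BlockNorm (toB6 (geo9Y x) 1 (H x)) (X x → ℝ))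
    (κA : MemberY d ℓ hd hL b₀ b₁ Mstar → Sizes310)
    (SHA S3A SIA SMA S2A : ∀ x : MemberY d ℓ hd hL b₀ b₁ Mstar, ι x → Finset (geo9Y x).Site)
    (hstA : ∀ x, StaticOK310 (𝔬A x) q.ρ q.Nc q.N' q.NF q.Cℓ (κA x)) (hκA : ∀ x, (κA x).Bounded q.Kc)
    (h36A : ∀ x, q.M₁ ≤ (geo9Y x).M → ∀ α₀ : ℝ, 0 < α₀ → c35 * (geo9Y x).M * α₀ ≤ q.a₁ →
      ∀ U : (bg x).Cfg, (bg x).Reg335 c35 α₀ U →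
        Local342G (𝔬A x) 1 (H x) q.B₀ q.δ₀ U ∧ B9Thm310Whole.Factors389 (𝔬A x) 1 (H x) q.θ₀ q.δ₀ U ∧
          Identities310 (𝔬A x) 1 (H x) U)
    (h36HA : ∀ x, q.M₁ ≤ (geo9Y x).M → ∀ α₀ : ℝ, 0 < α₀ → c35 * (geo9Y x).M * α₀ ≤ q.a₁ →
      ∀ U : (bg x).Cfg, (bg x).Reg335 c35 α₀ U →
        HolderLegs310 (𝔬A x) (𝔭A x) 1 (H x) (SHA x) q.Bl q.δ₀ U ∧ FactorsHolder310 (𝔬A x) (𝔭A x) 1 (H x) q.Bt q.δ₀ U ∧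
          (L2SecondLegs310 (𝔬A x) (𝔡A x) 1 (H x) (S3A x) q3.B3 q.δ₀ U ∧ FactorsL2Second310 (𝔬A x) (𝔡A x) 1 (H x) q3.θ3 q.δ₀ U ∧
            DirTranspose310 (𝔬A x) (𝔡A x) U) ∧
            (InputLegsPair310 (𝔬A x) (𝔡A x) (𝔭A x) 1 (H x) (bHXA x) (SIA x) q.BI q.BI2 q.δ₀ U ∧
              FactorsInputPair310 (𝔬A x) (𝔡A x) 1 (H x) (bHXA x) q.θI q.δ₀ U ∧ DirSupHolder310 (𝔬A x) (𝔡A x) (𝔭A x) 1 (H x) U) ∧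
              (L2MixedLegs310 (𝔬A x) (𝔡A x) 1 (H x) (SMA x) qM.BM q.δ₀ U ∧ FactorsL2Mixed310 (𝔬A x) (𝔡A x) 1 (H x) qM.θM q.δ₀ U ∧
                DirSup310 (𝔬A x) (𝔡A x) 1 (H x) U))
    -- the two-sided L² leg schema of Theorem 3.10 (the (3.46)₄ line of G(U) = ∇_UG∇*_U: n06-k's one-slot legs + their factors)
    (h36A2 : ∀ x, q.M₁ ≤ (geo9Y x).M → ∀ α₀ : ℝ, 0 < α₀ → c35 * (geo9Y x).M * α₀ ≤ q.a₁ →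
      ∀ U : (bg x).Cfg, (bg x).Reg335 c35 α₀ U →
        L2TwoLegs310 (𝔬A x) 1 (H x) (S2A x) q.B2 q.δ₀ U ∧ FactorsL2_310 (𝔬A x) 1 (H x) q.θ2 q.δ₀ U)
    (hcntHA : ∀ x (a : (geo9Y x).Site), (∑ c, if a ∈ SHA x c then (1 : ℝ) else 0) ≤ q.NH)
    (hcnt3A : ∀ x (a : (geo9Y x).Site), (∑ c, if a ∈ S3A x c then (1 : ℝ) else 0) ≤ q3.N3)
    (hcntIA : ∀ x (a : (geo9Y x).Site), (∑ c, if a ∈ SIA x c then (1 : ℝ) else 0) ≤ q.NI)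
    (hcntMA : ∀ x (a : (geo9Y x).Site), (∑ c, if a ∈ SMA x c then (1 : ℝ) else 0) ≤ qM.NM)
    (hcnt2A : ∀ x (a : (geo9Y x).Site), (∑ c, if a ∈ S2A x c then (1 : ℝ) else 0) ≤ q.N2)
    -- the symmetry of G(U) and the transposition (∇_UG)ᵀ = G∇*_U (theorems at the pins in the certificate)
    (hsymA : ∀ x, q.M₁ ≤ (geo9Y x).M → ∀ α₀ : ℝ, 0 < α₀ → c35 * (geo9Y x).M * α₀ ≤ q.a₁ →
      ∀ U : (bg x).Cfg, (bg x).Reg335 c35 α₀ U → IsTransposePair ((𝔬A x).G U) ((𝔬A x).G U))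
    (htrA : ∀ x, q.M₁ ≤ (geo9Y x).M → ∀ α₀ : ℝ, 0 < α₀ → c35 * (geo9Y x).M * α₀ ≤ q.a₁ →
      ∀ U : (bg x).Cfg, (bg x).Reg335 c35 α₀ U →
        IsTransposePair ((𝔬A x).D U ∘ₗ (𝔬A x).G U) ((𝔬A x).G U ∘ₗ (𝔬A x).Dstar U))
    -- the Theorem-3.12 letters of rows 20–21 and the identification G₀ := G(U) (p. 421; at def-Y's pins: the same coordinate models)
    (𝔬12 : ∀ x : MemberY d ℓ hd hL b₀ b₁ Mstar, B9Thm312Whole.Ops (geo9Y x) (bg x) (X x) (Y x) (Z x) (W x))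
    (hblk : ∀ x, (𝔬12 x).blk = (𝔬A x).blk) (hblkY : ∀ x, (𝔬12 x).blkY = (𝔬A x).blkY)
    (hG0 : ∀ x (U : (bg x).Cfg), (𝔬12 x).G0 U = (𝔬A x).G U) (hD : ∀ x (U : (bg x).Cfg), (𝔬12 x).D U = (𝔬A x).D U)
    (hDs : ∀ x (U : (bg x).Cfg), (𝔬12 x).Dstar U = (𝔬A x).Dstar U)
    -- rows 20–21's numerics and the ONE rate relation
    (θD12 r12 δ12₀ δK12 a12 M12 B12₃ δ12₃ t12 δT12 ρS σS : ℝ) (ha12 : 0 < a12) (hM12 : 0 < M12)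
    (hδ12₀ : δ12₀ ≤ (1 - 3 * q.αF) * ((1 - 2 * q.α) * q.δ₀)) (hB12₃ : 0 ≤ B12₃) (ht12 : 0 ≤ t12)
    -- the rates of the derived sup-class steps: a working rate ρS ≤ δT12 with ρS + σS ≤ min(δ12₀, δ12₃) ([4] (2.61) at rate σS > 0) and δK12 + α_Fδ ≤ ρS
    (hσS : 0 < σS) (hρS : 0 ≤ ρS) (hρST : ρS ≤ δT12) (hρS₀ : ρS + σS ≤ δ12₀) (hρS₃ : ρS + σS ≤ δ12₃)
    (hδKS : δK12 + q.αF * ((1 - 2 * q.α) * q.δ₀) ≤ ρS)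
    -- rows 20–21's GENUINE Sect.-D content in Theorem 3.12's regime: the steps, the form smallness, the identities, the two left steps
    (hrest12 : ∀ x : MemberY d ℓ hd hL b₀ b₁ Mstar, M12 ≤ (geo9Y x).M → ∀ α₀ : ℝ, 0 < α₀ → (geo9Y x).M * α₀ ≤ a12 →
      ∀ U : (bg x).Cfg, (bg x).Reg335 c35 α₀ U → (bg x).Reg336 c35 α₀ U →
        FormSmall (𝔬12 x) (r12 * ((geo9Y x).M * α₀)) U ∧ B9Thm312Whole.Identities (𝔬12 x) U)
    -- the G₀D entry of Theorem 3.3's type (the `gD2` field of row 21's `Letters313`, displayed there)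
    (hgD12 : ∀ x : MemberY d ℓ hd hL b₀ b₁ Mstar, M12 ≤ (geo9Y x).M → ∀ α₀ : ℝ, 0 < α₀ → (geo9Y x).M * α₀ ≤ a12 →
      ∀ U : (bg x).Cfg, (bg x).Reg335 c35 α₀ U → (bg x).Reg336 c35 α₀ U →
        HasMaj (cNorm 1 (H x) (𝔬12 x).blkW (fun y => (geo9Y_len_pos x y).le) 1)
          (cNorm 1 (H x) (𝔬12 x).blk (fun y => (geo9Y_len_pos x y).le) 2) ((𝔬12 x).G0 U ∘ₗ (𝔬12 x).Dv U)
          (fun a b => B12₃ * Real.exp (-(δ12₃ * (geo9Y x).dist a b))))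
    -- print's (3.131) ∕ (3.137): Δ′_π = T_a + D·T_b, Δ⁽²⁾_π = T_a₂ + D·T_b₂ with small local majorants t·e^{−δ_T d} (n06-l g11 `Letters3131`; FREE letters)
    (Ta Ta₂ : ∀ x : MemberY d ℓ hd hL b₀ b₁ Mstar, (bg x).Cfg → Module.End ℝ (X x → ℝ))
    (Tb Tb₂ : ∀ x : MemberY d ℓ hd hL b₀ b₁ Mstar, (bg x).Cfg → (X x → ℝ) →ₗ[ℝ] (W x → ℝ))
    (hL3131 : ∀ x : MemberY d ℓ hd hL b₀ b₁ Mstar, M12 ≤ (geo9Y x).M → ∀ α₀ : ℝ, 0 < α₀ → (geo9Y x).M * α₀ ≤ a12 →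
      ∀ U : (bg x).Cfg, (bg x).Reg335 c35 α₀ U → (bg x).Reg336 c35 α₀ U →
        Letters3131 (𝔬12 x) (Ta x) (Ta₂ x) (Tb x) (Tb₂ x) 1 (H x) (fun y => (geo9Y_len_pos x y).le) (t12 * ((geo9Y x).M * α₀)) δT12 U)
    (hstepD12 : ∀ x : MemberY d ℓ hd hL b₀ b₁ Mstar, M12 ≤ (geo9Y x).M → ∀ α₀ : ℝ, 0 < α₀ → (geo9Y x).M * α₀ ≤ a12 →
      ∀ U : (bg x).Cfg, (bg x).Reg335 c35 α₀ U → (bg x).Reg336 c35 α₀ U →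
        HasMaj (cNorm 1 (H x) (𝔬12 x).blk (fun y => (geo9Y_len_pos x y).le) 2)
            (cNorm 1 (H x) (𝔬12 x).blkY (fun y => (geo9Y_len_pos x y).le) 1)
            ((𝔬12 x).D U ∘ₗ (𝔬12 x).G0 U ∘ₗ (𝔬12 x).Tpi U)
            (fun a b => θD12 * ((geo9Y x).M * α₀) * Real.exp (-(δK12 * (toB6 (geo9Y x) 1 (H x)).dist a b))) ∧
          HasMaj (cNorm 1 (H x) (𝔬12 x).blk (fun y => (geo9Y_len_pos x y).le) 2)
            (cNorm 1 (H x) (𝔬12 x).blkY (fun y => (geo9Y_len_pos x y).le) 1)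
            ((𝔬12 x).D U ∘ₗ (𝔬12 x).G0 U ∘ₗ ((𝔬12 x).Tpi U + (𝔬12 x).T2 U))
            (fun a b => θD12 * ((geo9Y x).M * α₀) * Real.exp (-(δK12 * (toB6 (geo9Y x) 1 (H x)).dist a b)))) :
    ∃ (B12₀ : ℝ) (Bh12 Bi12 : ℝ → ℝ) (Bi2₁₂ : ℝ → ℝ → ℝ) (B12₂ θ12 M₀ a₀ : ℝ),
      0 ≤ B12₀ ∧ (∀ β, 0 ≤ β → β < 1 → 0 ≤ Bh12 β) ∧ (∀ ε, 0 < ε → ε ≤ 1 → 0 ≤ Bi12 ε) ∧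
        (∀ ε β, 0 < ε → ε ≤ 1 → 0 ≤ β → β < 1 → 0 ≤ Bi2₁₂ ε β) ∧ 0 ≤ B12₂ ∧ 0 ≤ θ12 ∧ 0 < M₀ ∧ 0 < a₀ ∧ M12 ≤ M₀ ∧ a₀ ≤ a12 ∧
        (∀ x : MemberY d ℓ hd hL b₀ b₁ Mstar, M₀ ≤ (geo9Y x).M → ∀ α₀ : ℝ, 0 < α₀ → (geo9Y x).M * α₀ ≤ a₀ →
          ∀ U : (bg x).Cfg, (bg x).Reg335 c35 α₀ U → (bg x).Reg336 c35 α₀ U →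
            Thm33G0 (𝔬12 x) 1 (H x) B12₀ δ12₀ U ∧
              B9Thm312Whole.Step (𝔬12 x) 1 (H x) (fun y => (geo9Y_len_pos x y).le) 1 (θ12 * ((geo9Y x).M * α₀)) δK12 U ∧
                B9Thm312Whole.Step (𝔬12 x) 1 (H x) (fun y => (geo9Y_len_pos x y).le) 2 (θ12 * ((geo9Y x).M * α₀)) δK12 U ∧
                  FormSmall (𝔬12 x) (r12 * ((geo9Y x).M * α₀)) U ∧ B9Thm312Whole.Identities (𝔬12 x) U) ∧
        (∀ x : MemberY d ℓ hd hL b₀ b₁ Mstar, M₀ ≤ (geo9Y x).M → ∀ α₀ : ℝ, 0 < α₀ → (geo9Y x).M * α₀ ≤ a₀ →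
          ∀ U : (bg x).Cfg, (bg x).Reg335 c35 α₀ U → (bg x).Reg336 c35 α₀ U →
            LeftStep (𝔬12 x) 1 (H x) (fun y => (geo9Y_len_pos x y).le) B12₀ δ12₀ (θD12 * ((geo9Y x).M * α₀)) δK12 U) ∧
        (∀ x : MemberY d ℓ hd hL b₀ b₁ Mstar, M₀ ≤ (geo9Y x).M → ∀ α₀ : ℝ, 0 < α₀ → (geo9Y x).M * α₀ ≤ a₀ →
          ∀ U : (bg x).Cfg, (bg x).Reg335 c35 α₀ U → (bg x).Reg336 c35 α₀ U →
            Thm33G0Dir (𝔬12 x) (𝔭A x) (𝔡A x).Dd (𝔡A x).Dsd 1 (H x) (bHXA x) B12₀ Bh12 Bi12 Bi2₁₂ δ12₀ U ∧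
              Thm33G0DirR (𝔬12 x) (𝔡A x).Dsd 1 (H x) B12₀ δ12₀ U ∧
                Thm33G0L2M (𝔬12 x) (𝔡A x).Dd (𝔡A x).Dsd 1 (H x) B12₂ δ12₀ U) := by
  -- [4] Lemma 2.1 (2.61) at (δ₀, α) and p. 398's member facts at ((1 − 2α)δ₀, α_F), above ONE threshold M_L (n06-i ∕ n06-k)
  obtain ⟨ML, h261, hfacts, -⟩ :=
    lemma21Pack_geo9Y (d := d) (ℓ := ℓ) (hd := hd) (hL := hL) (b₀ := b₀) (b₁ := b₁) (Mstar := Mstar) H hq.α_pos hq.α_lt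
      hq.δ₀_pos hq.αF_pos (by linarith [hq.αF_lt])
  -- the letters of the constants
  set dq : ℕ := exp261 (@geo9Y d ℓ hd hL b₀ b₁ Mstar) q.δ₀ q.α with hdq
  set dF : ℕ := exp261 (@geo9Y d ℓ hd hL b₀ b₁ Mstar) ((1 - 2 * q.α) * q.δ₀) (1 - q.αF) with hdF
  set L₀ : ℝ := ((ℓ + 1 : ℕ) : ℝ) with hL₀
  set C : ℝ := const37 dq q.δ₀ q.α q.ρ q.B₀ q.Nc q.N' q.Cℓ q.Kc with hCdef
  set Bh : ℝ → ℝ := fun β => holderConst dq q.δ₀ q.α q.NH q.NF C (q.Bl β) (q.Bt β) with hBh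
  set Bi : ℝ → ℝ := fun ε => inputConst44 dq q.δ₀ q.α q.NI q.NF C L₀ (q.BI ε) (q.θI ε) with hBi
  set Bi2 : ℝ → ℝ → ℝ := fun ε β => inputConst45 dq q.δ₀ q.α q.NI q.NF L₀ (Bh β) (q.BI2 ε β) (q.θI (β + ε)) with hBi2
  set B₂ : ℝ := max (max (C * L₀) (secondConst dq q.δ₀ q.α q3.N3 q3.B3 q.NF q3.θ3 C L₀ * L₀))
    (max (mixedConst dq q.δ₀ q.α qM.NM qM.BM q.NF qM.θM C L₀) (twoConst dq q.δ₀ q.α q.N2 q.B2 q.NF q.θ2 C L₀)) with hB₂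
  -- [4] (2.61) for the record geometry at the step's row-sum rate σS (n06-i `rowSum261_geo9Y`), constant `max cσ 0`
  obtain ⟨MLσ, cσ, hrow0⟩ := rowSum261_geo9Y (d := d) (ℓ := ℓ) (hd := hd) (hL := hL) (b₀ := b₀) (b₁ := b₁) (Mstar := Mstar) σS hσS
  set c' : ℝ := max cσ 0 with hc'
  have hc'0 : 0 ≤ c' := le_max_right _ _
  have hrow : ∀ x : MemberY d ℓ hd hL b₀ b₁ Mstar, MLσ ≤ (geo9Y x).M → RowSum (toB6 (geo9Y x) 1 (H x)) σS c' :=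
    fun x hM y => (hrow0 x hM y).trans (le_max_left _ _)
  set θ12 : ℝ := 2 * ((C + B12₃) * t12 * c') * L₀ with hθ12
  set M₀ : ℝ := max M12 (max q.M₁ (max ML (max 1 (max (2 * q.NF * q.θ₀ * B6.c1 dq q.δ₀ q.α) MLσ)))) with hM₀
  set a₀ : ℝ := min a12 (q.a₁ / c35) with ha₀
  -- signs
  obtain ⟨hN3, hB3, hθ3⟩ := hq3
  obtain ⟨hNM, hBM, hθM⟩ := hqM
  have hCℓ0 : 0 ≤ q.Cℓ := zero_le_one.trans hq.one_le_Cℓ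
  have hC : 0 ≤ C := B9RWSumsCompleteGeo9Y.const37_nonneg_of_signs dq hq.B₀_pos.le hq.Nc_nn hq.N'_nn hCℓ0 hq.Kc_nn
  have hL₀1 : 1 ≤ L₀ := by rw [hL₀]; exact_mod_cast Nat.succ_le_succ (Nat.zero_le _)
  have hL₀0 : 0 ≤ L₀ := zero_le_one.trans hL₀1
  have hBh0 : ∀ β, 0 ≤ β → β < 1 → 0 ≤ Bh β := fun β hβ0 hβ1 =>
    holderConst_nonneg' hq.NH_nn hq.NF_nn hC (hq.Bl_nn β hβ0 hβ1) (hq.Bt_nn β hβ0 hβ1)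
  have hBi0 : ∀ ε, 0 < ε → ε ≤ 1 → 0 ≤ Bi ε := fun ε hε hε1 =>
    inputConst44_nonneg' hq.NI_nn hq.NF_nn hC hL₀0 (hq.BI_nn ε hε hε1) (hq.θI_nn ε hε)
  have hBi20 : ∀ ε β, 0 < ε → ε ≤ 1 → 0 ≤ β → β < 1 → 0 ≤ Bi2 ε β := fun ε β hε hε1 hβ0 hβ1 =>
    inputConst45_nonneg' hq.NI_nn hq.NF_nn hL₀0 (hBh0 β hβ0 hβ1) (hq.BI2_nn ε β hε hε1 hβ0 hβ1) (hq.θI_nn (β + ε) (by linarith))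
  have hB₂0 : 0 ≤ B₂ := le_trans (mul_nonneg hC hL₀0) ((le_max_left _ _).trans (le_max_left _ _))
  have hθ12nn : 0 ≤ θ12 := mul_nonneg (mul_nonneg (by norm_num) (mul_nonneg (mul_nonneg (add_nonneg hC hB12₃) ht12) hc'0)) hL₀0
  have hM₀pos : 0 < M₀ := lt_of_lt_of_le hM12 (le_max_left _ _)
  have ha₀pos : 0 < a₀ := lt_min ha12 (div_pos hq.a₁_pos hc35)
  -- the rates: δ := (1 − 2α)δ₀ > 0, δ12₀ ≤ (1 − 3α_F)δ ≤ (1 − α_F)δ ≤ δ ≤ (1 − α)δ₀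
  have hδpos : 0 < (1 - 2 * q.α) * q.δ₀ := mul_pos (by linarith [hq.α_lt]) hq.δ₀_pos
  have hαFδ : 0 ≤ q.αF * ((1 - 2 * q.α) * q.δ₀) := mul_nonneg hq.αF_pos.le hδpos.le
  have hρ3 : δ12₀ ≤ (1 - 3 * q.αF) * ((1 - 2 * q.α) * q.δ₀) := hδ12₀
  have hρ1 : δ12₀ ≤ (1 - q.αF) * ((1 - 2 * q.α) * q.δ₀) := by nlinarith [hρ3, hαFδ]
  have hρ0 : δ12₀ ≤ (1 - 2 * q.α) * q.δ₀ := by nlinarith [hρ1, hαFδ]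
  have hδle : (1 - 2 * q.α) * q.δ₀ ≤ (1 - q.α) * q.δ₀ := by nlinarith [hq.α_pos, hq.δ₀_pos]
  have hαδ1 : q.αF * ((1 - 2 * q.α) * q.δ₀) ≤ (1 - 2 * q.α) * q.δ₀ := by nlinarith [hq.αF_lt, hδpos]
  have hα2' : 2 * q.αF * ((1 - 2 * q.α) * q.δ₀) ≤ (1 - 2 * q.α) * q.δ₀ := by nlinarith [hq.αF_lt, hδpos]
  have hα₁δ₀ : 0 ≤ q.α * q.δ₀ := mul_nonneg hq.α_pos.le hq.δ₀_pos.le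
  have hrate : (1 - 2 * q.αF) * ((1 - 2 * q.α) * q.δ₀) ≤ (1 - q.α) * q.δ₀ := by nlinarith [hq.αF_pos, hδpos, hδle]
  refine ⟨C, Bh, Bi, Bi2, B₂, θ12, M₀, a₀, hC, hBh0, hBi0, hBi20, hB₂0, hθ12nn, hM₀pos, ha₀pos, le_max_left _ _, min_le_left _ _,
    fun x hM α₀ hα ha U hU hU' => ?_, fun x hM α₀ hα ha U hU hU' => ?_, fun x hM α₀ hα ha U hU hU' => ?_⟩
  all_goals
    -- the member's regime: above every threshold, below both smallness bounds
    have hM12x : M12 ≤ (geo9Y x).M := le_trans (le_max_left _ _) hM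
    have hMq : q.M₁ ≤ (geo9Y x).M := le_trans ((le_max_left _ _).trans (le_max_right _ _)) hM
    have hMLx : ML ≤ (geo9Y x).M := le_trans (((le_max_left _ _).trans (le_max_right _ _)).trans (le_max_right _ _)) hM
    have hM1 : 1 ≤ (geo9Y x).M :=
      le_trans ((((le_max_left _ _).trans (le_max_right _ _)).trans (le_max_right _ _)).trans (le_max_right _ _)) hM
    have hbig : 2 * q.NF * q.θ₀ * B6.c1 dq q.δ₀ q.α ≤ (geo9Y x).M :=
      le_trans (((((le_max_left _ _).trans (le_max_right _ _)).trans (le_max_right _ _)).trans (le_max_right _ _)).trans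
        (le_max_right _ _)) hM
    have hMLσx : MLσ ≤ (geo9Y x).M :=
      le_trans (((((le_max_right _ _).trans (le_max_right _ _)).trans (le_max_right _ _)).trans (le_max_right _ _)).trans
        (le_max_right _ _)) hM
    have hMpos : 0 < (geo9Y x).M := lt_of_lt_of_le one_pos hM1
    have ha12x : (geo9Y x).M * α₀ ≤ a12 := ha.trans (min_le_left _ _)
    have haq : c35 * (geo9Y x).M * α₀ ≤ q.a₁ := by
      have h1 : c35 * ((geo9Y x).M * α₀) ≤ c35 * (q.a₁ / c35) :=
        mul_le_mul_of_nonneg_left (ha.trans (min_le_right _ _)) hc35.le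
      rw [mul_div_cancel₀ _ hc35.ne'] at h1
      simpa only [mul_assoc] using h1
    have hq' : q.NF * (q.θ₀ * (geo9Y x).M⁻¹) * B6.c1 dq q.δ₀ q.α ≤ 1 / 2 := small_of_threshold hMpos hbig
    have hlen : ∀ y : (geo9Y x).Site, 0 ≤ (geo9Y x).len y := fun y => (geo9Y_len_pos x y).le
    obtain ⟨hl, hf, hi⟩ := h36A x hMq α₀ hα haq U hU
    obtain ⟨hL, hFH, ⟨hL3, hF3, hDT⟩, ⟨hIL, hFI, hDH⟩, ⟨hLM, hFM, hDS⟩⟩ := h36HA x hMq α₀ hα haq U hU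
    obtain ⟨hL2, hF2⟩ := h36A2 x hMq α₀ hα haq U hU
    have hc : Conv3107 (𝔬A x) 1 (H x) C ((1 - 2 * q.α) * q.δ₀) U :=
      conv3107_of_local3107 (𝔬A x) 1 (H x) dq q.δ₀ q.α q.ρ q.B₀ q.Nc q.N' q.NF q.Cℓ q.Kc q.θ₀ (κA x) U hq.B₀_pos.le
        hq.δ₀_pos.le hq.α_pos.le hq.α_lt.le hq.Nc_nn hq.N'_nn hq.NF_nn hq.one_le_Cℓ hq.Kc_nn hq.θ₀_nn hMpos (hstA x) (hκA x)
        (h261 x hMLx) hq' hl hf hi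
  · have h33 : Thm33G0 (𝔬12 x) 1 (H x) C δ12₀ U :=
      thm33G0_of_conv3107 (𝔬12 x) (𝔬A x) (hblk x) (hblkY x) (hG0 x U) (hDs x U) hC hρ0 (hstA x).dnn hlen hc
    have hgeo : GeoOK (geo9Y x) := ⟨(hstA x).tri, (hstA x).symm, (hstA x).dnn, (hstA x).lenpos⟩
    have hMα : 0 ≤ (geo9Y x).M * α₀ := mul_nonneg hMpos.le hα.le
    have hθ : 2 * ((C + B12₃) * (t12 * ((geo9Y x).M * α₀)) * c') * L₀ ≤ θ12 * ((geo9Y x).M * α₀) :=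
      le_of_eq (by rw [hθ12]; ring)
    have hst := step_of_letters3131 (R₀ := 1) (H₀ := H x) hgeo (hfacts x hMLx) (hrow x hMLσx) hc'0 hC hB12₃ (mul_nonneg ht12 hMα)
      hρS hρST hρS₀ hρS₃ hαFδ hθ hδKS h33 (hgD12 x hM12x α₀ hα ha12x U hU hU') (hL3131 x hM12x α₀ hα ha12x U hU hU')
    exact ⟨h33, hst.1, hst.2, hrest12 x hM12x α₀ hα ha12x U hU hU'⟩
  · exact leftStep_of_conv3107 (𝔬12 x) (𝔬A x) (fun y => (geo9Y_len_pos x y).le) (hblk x) (hblkY x) (hG0 x U) (hD x U) hC hρ0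
      (hstA x).dnn hc (hstepD12 x hM12x α₀ hα ha12x U hU hU').1 (hstepD12 x hM12x α₀ hα ha12x U hU hU').2
  · refine ⟨?_, thm33G0DirR_of_conv3107 (𝔬12 x) (𝔬A x) (𝔡A x) (hblk x) (hG0 x U) hC hρ0 (hstA x).dnn hlen hc hDS, ?_⟩
    · exact thm33G0Dir_of_conv3107 (𝔬12 x) (𝔬A x) (𝔡A x) (𝔭A x) (bHXA x) dF dq ((1 - 2 * q.α) * q.δ₀) q.αF L₀ q.δ₀ q.α q.ρ
        q.Nc q.N' q.NF q.Cℓ q.θ₀ q.NH q.NI C δ12₀ (κA x) (SHA x) (SIA x) q.Bl q.Bt q.BI q.θI q.BI2 U (hblk x) (hblkY x) (hG0 x U)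
        (hD x U) (hDs x U) hq.δ₀_pos.le hq.α_pos.le (by linarith [hq.α_lt]) hq.NF_nn hq.θ₀_nn hq.NH_nn hq.NI_nn hM1 hC hδpos.le
        hδle hαFδ hαδ1 hρ1 hq.Bl_nn hq.Bt_nn hq.BI_nn hq.BI2_nn hq.θI_nn (hstA x) (hcntHA x) (hcntIA x) (h261 x hMLx) hq'
        (hfacts x hMLx) hf hi hL hFH hIL hFI hDS hDH hc
    · exact thm33G0L2M_of_conv3107 (𝔬12 x) (𝔬A x) (𝔡A x) dF dq ((1 - 2 * q.α) * q.δ₀) q.αF L₀ q.δ₀ q.α q.ρ q.Nc q.N' q.NF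
        q.Cℓ q.N2 q.B2 q.θ2 q3.N3 q3.B3 q3.θ3 qM.NM qM.BM qM.θM C B₂ δ12₀ (κA x) (S2A x) (S3A x) (SMA x) U (hblk x) (hblkY x)
        (hG0 x U) (hD x U) (hDs x U) hq.NF_nn hq.N2_nn hq.B2_nn hq.θ2_nn hN3 hB3 hθ3 hNM hBM hθM hM1 hC hαFδ hα2' hα₁δ₀ hrate
        ((le_max_left _ _).trans (le_max_left _ _)) ((le_max_right _ _).trans (le_max_left _ _))
        ((le_max_left _ _).trans (le_max_right _ _)) ((le_max_right _ _).trans (le_max_right _ _)) hρ3 (hstA x) (hcnt2A x)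
        (hcnt3A x) (hcntMA x) (h261 x hMLx) (hfacts x hMLx) hi hL2 hF2 hL3 hF3 hLM hFM hDS hDT (hsymA x hMq α₀ hα haq U hU)
        (htrA x hMq α₀ hα haq U hU) hc

end Summit.QuantumFields.YangMills.BalabanUVNodes.N06G0LayerFromThm310

end
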